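import Summits.Ventures.PercRepro.C041TriDomExcessConvMain

/-!
# ROW C-041 — THE EQUALITY CASE OF THE EXCESS, XII: THE CONTRACTION MINOR — A TRIANGLE OR A STAR ON THE MARKS
(p6, gen 44; P6-TWOEXIT-LEAN.md §53 ADDENDUM 11, the Menger-type alternative in contracted form)

The induction of `C041TriDomExcessConvMain` only ever CONTRACTS; read with the minor as its conclusion it is the
Menger-type alternative of ADDENDUM 2 in contracted form: **a host whose marks are connected and pairwise not
separated by the third has a CONTRACTION (a status with no absent edge, `ContrOf`) in which the three mark classes
are pairwise joined by free edges (a triangle, `Tri`) or a fourth class is joined by free edges to all three (a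
star, `Star`)** — `nonSep_contr_star_or_tri` for statuses, `contr_star_or_tri_of_not_separable` for the host.
Conversely such a contraction forces `e ≥ 1` (`excess_ge_one_of_star'`, `excess_ge_one_of_tri'`: the classes of the
marks distinct is all the minor theorems need).  **THEOREM (THREE CHARACTERISATIONS OF `e ≥ 1`)**
(`excess_ge_one_iff_contr`): `e ≥ 1` ⟺ the host is not separable ⟺ it has such a contraction minor.
-/

namespace PercRepro

namespace ZoneZ

namespace MultiExit

open ZoneData Finset

variable {V₁ E₁ U₁ U₂ : Type} (Z₁ : ZoneData V₁ E₁ U₁ U₂) (u u' a₁ : V₁)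

/-! ## Contractions -/

/-- `st'` is obtained from `st` by contracting free edges only. -/
def ContrOf (st st' : E₁ → EStat) : Prop := ∀ e, st' e = st e ∨ (st e = .free ∧ st' e = .double)

omit Z₁ in
/-- Every status is a contraction of itself. -/
theorem ContrOf.refl (st : E₁ → EStat) : ContrOf st st := fun _ => Or.inl rfl

omit Z₁ in
/-- Contractions compose. -/
theorem ContrOf.trans {st st' st'' : E₁ → EStat} (h1 : ContrOf st st') (h2 : ContrOf st' st'') : ContrOf st st'' := by
  intro e
  rcases h2 e with h | ⟨hf, hd⟩
  · rw [h]; exact h1 e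
  · rcases h1 e with h' | ⟨hf', _⟩
    · rw [h'] at hf; exact Or.inr ⟨hf, hd⟩
    · exact Or.inr ⟨hf', hd⟩

omit Z₁ in
/-- Contracting one free edge is a contraction. -/
theorem ContrOf.update [DecidableEq E₁] {st : E₁ → EStat} {f : E₁} (hf : st f = .free) :
    ContrOf st (Function.update st f .double) := by
  intro e
  by_cases he : e = f
  · subst he; exact Or.inr ⟨hf, by simp⟩
  · exact Or.inl (Function.update_of_ne he _ _)

omit Z₁ in
/-- A contraction of a status without absent edges has no absent edge. -/
theorem ContrOf.ne_absent {st st' : E₁ → EStat} (h : ContrOf st st') (hst : ∀ e, st e ≠ .absent) (e : E₁) :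
    st' e ≠ .absent := by
  rcases h e with h' | ⟨_, hd⟩
  · rw [h']; exact hst e
  · rw [hd]; exact fun h => EStat.noConfusion h

variable [DecidableEq E₁] [Fintype E₁]

/-! ## The induction, with the minor as its conclusion -/

/-- **THE CONTRACTION MINOR, STATUS FORM**: a non-separable status contracts to a star or a triangle on the marks
(the induction of `excess_ge_one_of_nonSep`, read constructively). -/
theorem nonSep_contr_star_or_tri (n : ℕ) :
    ∀ st : E₁ → EStat, nfree st = n → NonSep Z₁ st a₁ u u' →
      ∃ st', ContrOf st st' ∧ NonSep Z₁ st' a₁ u u' ∧ (Star Z₁ st' a₁ u u' ∨ Tri Z₁ st' a₁ u u') := by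
  induction n using Nat.strong_induction_on with
  | _ n ih =>
  intro st hn h
  have hstep : ∀ f, st f = .free → NonSep Z₁ (Function.update st f .double) a₁ u u' →
      ∃ st', ContrOf st st' ∧ NonSep Z₁ st' a₁ u u' ∧ (Star Z₁ st' a₁ u u' ∨ Tri Z₁ st' a₁ u u') := by
    intro f hf h'
    have hlt : nfree (Function.update st f .double) < n := by
      have := nfree_update hf (s := .double) (by decide)
      omega
    obtain ⟨st', hc, hns, hm⟩ := ih _ hlt _ rfl h'
    exact ⟨st', (ContrOf.update hf).trans hc, hns, hm⟩
  by_cases hoff : ∃ f, st f = .free ∧ ∃ p q, Z₁.Joins f p q ∧ OffMarks Z₁ st a₁ u u' p ∧ OffMarks Z₁ st a₁ u u' q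
  · obtain ⟨f, hf, p, q, hj, hp, hq⟩ := hoff
    exact hstep f hf (NonSep.contract_off Z₁ h hf hj hp hq)
  have hT : Touching Z₁ st a₁ u u' := by
    intro f hf p q hj
    by_contra hc
    push Not at hc
    exact hoff ⟨f, hf, p, q, hj, hc.1, hc.2⟩
  by_cases hstar : Star Z₁ st a₁ u u'
  · exact ⟨st, ContrOf.refl st, h, Or.inl hstar⟩
  by_cases htri : Tri Z₁ st a₁ u u'
  · exact ⟨st, ContrOf.refl st, h, Or.inr htri⟩
  by_cases h1 : ∃ f, FreeJoin Z₁ st f a₁ u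
  · by_cases h2 : ∃ f, FreeJoin Z₁ st f a₁ u'
    · have h3 : ¬ ∃ f, FreeJoin Z₁ st f u u' := fun h3 => htri ⟨h1, h2, h3⟩
      rcases NonSep.reduce Z₁ h.swap12 hT.swap12 h3 with hs | ⟨f, hf, h'⟩
      · exact absurd hs.swap12 hstar
      · exact hstep f hf h'.swap12
    · rcases NonSep.reduce Z₁ h hT h2 with hs | ⟨f, hf, h'⟩
      · exact absurd hs hstar
      · exact hstep f hf h'
  · rcases NonSep.reduce Z₁ h.swap23 hT.swap23 h1 with hs | ⟨f, hf, h'⟩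
    · exact absurd hs.swap23 hstar
    · exact hstep f hf h'.swap23

/-- **THE CONTRACTION MINOR OF A NON-SEPARABLE HOST**: if the marks are connected and no mark separates the other
two, some contraction of the host (no edge deleted) carries a star or a triangle of free edges on the marks, with
the three mark classes pairwise distinct. -/
theorem contr_star_or_tri_of_not_separable (h : ¬ SeparableS Z₁ u u' a₁ (fun _ => EStat.free)) :
    ∃ st : E₁ → EStat, (∀ e, st e ≠ .absent) ∧ ¬ DConn Z₁ st a₁ u ∧ ¬ DConn Z₁ st a₁ u' ∧ ¬ DConn Z₁ st u u' ∧
      (Star Z₁ st a₁ u u' ∨ Tri Z₁ st a₁ u u') := by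
  obtain ⟨st, hc, hns, hm⟩ :=
    nonSep_contr_star_or_tri Z₁ u u' a₁ _ _ rfl (nonSep_free_of_not_separable Z₁ u u' a₁ h)
  exact ⟨st, hc.ne_absent (fun _ h => EStat.noConfusion h), hns.nxy, hns.nxz, hns.nyz, hm⟩

/-! ## The converse: a star or a triangle of free edges forces `e ≥ 1` -/

/-- A star of free edges between pairwise distinct mark classes forces `e ≥ 1`. -/
theorem excess_ge_one_of_star' {st : E₁ → EStat} (hau : ¬ DConn Z₁ st a₁ u) (hau' : ¬ DConn Z₁ st a₁ u')
    (huu' : ¬ DConn Z₁ st u u') (hs : Star Z₁ st a₁ u u') : 1 ≤ excess Z₁ u u' a₁ := by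
  obtain ⟨w, hw, ⟨f₁, hf1, p₁, q₁, hj1, hw1, ha1⟩, ⟨f₂, hf2, p₂, q₂, hj2, hw2, hu2⟩,
    ⟨f₃, hf3, p₃, q₃, hj3, hw3, hu3⟩⟩ := hs
  have hD := DConn_keepThree Z₁ st f₁ f₂ f₃
  refine excess_ge_one_of_starMinor Z₁ u u' a₁ (st := keepThree st f₁ f₂ f₃) (c := w) (f₁ := f₁) (f₂ := f₂)
    (f₃ := f₃) ?_
  refine ⟨threeFree_keepThree hf1 hf2 hf3, ?_, ?_, ?_, ?_, ?_, ?_, ?_, ?_, ?_⟩ <;> rw [hD]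
  · exact fun h' => hw.1 (DConn_symm Z₁ h')
  · exact fun h' => hw.2.1 (DConn_symm Z₁ h')
  · exact fun h' => hw.2.2 (DConn_symm Z₁ h')
  · exact hau
  · exact hau'
  · exact huu'
  · exact ⟨p₁, q₁, hj1, hw1, ha1⟩
  · exact ⟨p₂, q₂, hj2, hw2, hu2⟩
  · exact ⟨p₃, q₃, hj3, hw3, hu3⟩

/-- A triangle of free edges between pairwise distinct mark classes forces `e ≥ 1`. -/
theorem excess_ge_one_of_tri' {st : E₁ → EStat} (hau : ¬ DConn Z₁ st a₁ u) (hau' : ¬ DConn Z₁ st a₁ u')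
    (huu' : ¬ DConn Z₁ st u u') (ht : Tri Z₁ st a₁ u u') : 1 ≤ excess Z₁ u u' a₁ := by
  obtain ⟨⟨f₁, hf1, p₁, q₁, hj1, ha1, hu1⟩, ⟨f₂, hf2, p₂, q₂, hj2, ha2, hu2⟩,
    ⟨f₃, hf3, p₃, q₃, hj3, hu3, hu3'⟩⟩ := ht
  have hD := DConn_keepThree Z₁ st f₁ f₂ f₃
  refine excess_ge_one_of_triMinor Z₁ u u' a₁ (st := keepThree st f₁ f₂ f₃) (f₁ := f₁) (f₂ := f₂) (f₃ := f₃) ?_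
  refine ⟨threeFree_keepThree hf1 hf2 hf3, ?_, ?_, ?_, ?_, ?_, ?_⟩ <;> rw [hD]
  · exact hau
  · exact hau'
  · exact huu'
  · exact ⟨p₁, q₁, hj1, ha1, hu1⟩
  · exact ⟨p₂, q₂, hj2, ha2, hu2⟩
  · exact ⟨p₃, q₃, hj3, hu3, hu3'⟩

/-- **THEOREM (THREE CHARACTERISATIONS OF `e ≥ 1`)**: the excess of a three-marked host is at least one iff the
host is not separable iff some status with no absent edge and pairwise distinct mark classes carries a star or a
triangle of free edges on the marks. -/
theorem excess_ge_one_iff_contr :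
    (1 ≤ excess Z₁ u u' a₁ ↔ ¬ SeparableS Z₁ u u' a₁ (fun _ => EStat.free)) ∧
    (1 ≤ excess Z₁ u u' a₁ ↔ ∃ st : E₁ → EStat, (∀ e, st e ≠ .absent) ∧ ¬ DConn Z₁ st a₁ u ∧
      ¬ DConn Z₁ st a₁ u' ∧ ¬ DConn Z₁ st u u' ∧ (Star Z₁ st a₁ u u' ∨ Tri Z₁ st a₁ u u')) := by
  refine ⟨excess_ge_one_iff_not_separable Z₁ u u' a₁, ⟨fun h => ?_, fun h => ?_⟩⟩
  · exact contr_star_or_tri_of_not_separable Z₁ u u' a₁ ((excess_ge_one_iff_not_separable Z₁ u u' a₁).1 h)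
  · obtain ⟨st, _, hau, hau', huu', hm⟩ := h
    rcases hm with hs | ht
    · exact excess_ge_one_of_star' Z₁ u u' a₁ hau hau' huu' hs
    · exact excess_ge_one_of_tri' Z₁ u u' a₁ hau hau' huu' ht

end MultiExit

end ZoneZ

end PercRepro
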